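import Mathlib
import Literature.Geometry.Lorentzian.ReggeWheelerTortoise
import Literature.Geometry.Lorentzian.ReggeWheelerChannels

/-!
# Exact-action (Langer–Liouville) normal form of the Regge–Wheeler mode equation — ENGINE SKETCH

Crux `PhotonSphereChannels.UniformPhotonSphereChannelsR` (K1R, item stmt-FinalStateConjecture-14074),
idea `exact-action-langer-transport`, crux-plan seat
`planner-cruxplan-stmt-FinalStateConjecture-14074-exact-action-langer--0`, 2026-08-16.

VERDICT OF THE CRUX-PLAN: **no skeleton** for the transport line (its load-bearing Transfer (T1) —
"Schwarzschild far translation representation = e^{iδ_ℓ(D)} ∘ flat ∘ 𝒥 with an ω-free relabelling 𝒥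
and ‖error‖ ≤ c₀M/x_f" — is false as stated: triage r1-1 job j013241-B and r1-3 App. B, and this seat's
`calc/lag_lobes.py`; its exact repair is the translation representation itself, i.e. stub S2 of the
mirror/Hankel line `mirror-nehari-blaschke`).  What survives, and is recorded here as TYPED statements
(no proofs — planner seat; `lean check` rc 0, 0 sorries), is the ENGINE every symbol-based far line needs
for its uniformity stub (mirror S5): the exact Liouville normal form of the spin-`s` Regge–Wheeler
operator in the Langer/exact-action variable `ξ = arcosh(r/M − 1)`,

  `φ_ξξ = ((ℓ + ½)² − ω² b(r)² + E_s(r)) φ`,  `b = r/√(1 − 2M/r)`,  `φ = F^{1/4} ψ`, `F = (1 − 2M/r)/r²`,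

with the `ℓ`- AND `ω`-FREE Coulomb-small remainder
`E_s(r) = (1 − s²)·2M/r − M(8r − 15M)/(4r(r − 2M))`, `|E_s| ≤ 33M/(4r)` on `r ≥ 3M`, `s ≤ 2`
(closed form: this seat by hand = triage r1-2 (E1): `R − ¼ = −2M/r − M²/(4r(r−2M))`; flat `M = 0`
gives Langer's `¼` exactly).  Consequence (informal, see `Lines/exact-action-langer-transport.md`):
Olver's LG / one-turning-point error bounds apply with large parameter `ν = ℓ + ½`, principal symbol
`1 − (ω/ν)² b²` EXACT (no expansion of the Coulomb logarithm), and error-control variation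
`∫ |E_s| dξ ≲ ∫ M r⁻² dx = O(M/r_f)` — uniform phase control of the far (Neumann-mirror) reflection
symbol outside the grazing (Airy) layer, which is what mirror stub S5 consumes.

Namespace `…Cruxes.UniformPhotonSphereChannelsR.ExactActionEngine`; nothing here is an item.
-/

noncomputable section

namespace Summit.FinalStateConjecture.FinalStateConjecture.Cruxes.UniformPhotonSphereChannelsR.ExactActionEngine

open Literature.Geometry.Lorentzian Literature.Geometry.Lorentzian.ReggeWheeler

/-- The optical factor `F(x) = (1 − 2M/r(x))/r(x)²` on the tortoise line, so that
`V_{s,ℓ} = F·(ℓ(ℓ+1) + (1 − s²)·2M/r)` (`linePotential_eq_opticalF_mul` below states this). -/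
def opticalF (M : ℝ) (r : ℝ → ℝ) (x : ℝ) : ℝ := (1 - 2 * M / r x) / r x ^ 2

/-- The impact-parameter radius `b(x) = r/√(1 − 2M/r) = F^{−1/2}`: a null geodesic of impact
parameter `β = ν/ω` turns where `b(r) = β`; `b` is minimal (`3√3 M`) at the photon sphere. -/
def impactRadius (M : ℝ) (r : ℝ → ℝ) (x : ℝ) : ℝ := r x / Real.sqrt (1 - 2 * M / r x)

/-- The exact-action / Langer variable `ξ(x) = arcosh(r(x)/M − 1) = log(z + √(z² − 1))`,
`z = (r − M)/M` (`z > 1` on the exterior `r > 2M`). -/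
def langerXi (M : ℝ) (r : ℝ → ℝ) (x : ℝ) : ℝ :=
  Real.log ((r x - M) / M + Real.sqrt (((r x - M) / M) ^ 2 - 1))

/-- The `ℓ`- and `ω`-free Liouville remainder of the spin-`s` Regge–Wheeler operator in the
variable `ξ`: `E_s(ρ) = (1 − s²)·2M/ρ − M(8ρ − 15M)/(4ρ(ρ − 2M))`
(second term `= R − ¼`, `R := −F^{−3/4} (F^{−1/4})_{xx} = (ρ² − 10Mρ + 15M²)/(4ρ(ρ − 2M))`). -/
def liouvilleRemainder (M : ℝ) (s : ℕ) (ρ : ℝ) : ℝ :=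
  (1 - (s : ℝ) ^ 2) * (2 * M) / ρ - M * (8 * ρ - 15 * M) / (4 * ρ * (ρ - 2 * M))

/-- `V_{s,ℓ} = F · (ℓ(ℓ+1) + (1 − s²)·2M/r)` pointwise (algebra; recorded as a statement). -/
def LinePotentialFactorisation : Prop :=
  ∀ (M : ℝ) (s ℓ : ℕ) (r : ℝ → ℝ) (x : ℝ), r x ≠ 0 →
    linePotential M s ℓ r x =
      opticalF M r x * ((ℓ : ℝ) * ((ℓ : ℝ) + 1) + (1 - (s : ℝ) ^ 2) * (2 * M) / r x)

/-- **`LangerActionDeriv`** (card's first lemma, checked by hand by all three triagers):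
along a tortoise radius function, `dξ/dx = √F = √(1 − 2M/r)/r`
(`d/dx arcosh(r/M − 1) = r′/√((r − M)² − M²) = (1 − 2M/r)/√(r(r − 2M))`). -/
def LangerActionDeriv : Prop :=
  ∀ (M : ℝ) (r : ℝ → ℝ) (xc : ℝ), IsTortoiseRadius M r xc →
    ∀ x : ℝ, HasDerivAt (langerXi M r) (Real.sqrt (opticalF M r x)) x

/-- **`LiouvilleNormalForm`** — the exact-action normal form, stated along `x` (no inverse function):
if `ψ ∈ C²(ℝ)` solves the mode equation `ψ'' = (V_{s,ℓ} − ω²) ψ`, then `φ := F^{1/4} ψ` satisfies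
`F^{−1/2} (F^{−1/2} φ′)′ = ((ℓ + ½)² − ω²/F + E_s(r)) φ`, i.e. `φ_ξξ = (ν² − ω² b² + E_s) φ` with
`d/dξ = F^{−1/2} d/dx`.  (By hand: `ψ'' = F^{3/4} φ_ξξ + (F^{−1/4})'' φ`, the `φ_ξ` terms cancel, and
`−F^{−3/4}(F^{−1/4})'' = ¼ − M(8r − 15M)/(4r(r − 2M))` using `r′ = 1 − 2M/r`; `M = 0`: Langer's `¼`.) -/
def LiouvilleNormalForm : Prop :=
  ∀ (M : ℝ) (r : ℝ → ℝ) (xc : ℝ), IsTortoiseRadius M r xc →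
    ∀ (s ℓ : ℕ) (ω : ℝ) (ψ : ℝ → ℝ), ContDiff ℝ 2 ψ →
      (∀ x, iteratedDeriv 2 ψ x = (linePotential M s ℓ r x - ω ^ 2) * ψ x) →
        let F : ℝ → ℝ := opticalF M r
        let φ : ℝ → ℝ := fun x => Real.sqrt (Real.sqrt (F x)) * ψ x
        ∀ x, (Real.sqrt (F x))⁻¹ * deriv (fun y => (Real.sqrt (F y))⁻¹ * deriv φ y) x =
          ((((ℓ : ℝ) + 1 / 2) ^ 2 - ω ^ 2 / F x + liouvilleRemainder M s (r x)) * φ x)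

/-- **`LiouvilleRemainderBound`**: `|E_s(ρ)| ≤ 33M/(4ρ)` for `ρ ≥ 3M`, `M > 0`, `s ≤ 2`
(`|(1 − s²)2M/ρ| ≤ 6M/ρ` and `(R − ¼)·ρ/M = −2 − M/(4(ρ − 2M)) ∈ [−9/4, −2)` on `ρ ≥ 3M`, equality at
the photon sphere; triage r1-2 E1).  On the far side `ρ ≥ r_f → ∞` along the log edge this is the
`ℓ`-, `ω`-uniform `O(M/r_f)` perturbation that Olver's error-control function integrates. -/
def LiouvilleRemainderBound : Prop :=
  ∀ M : ℝ, 0 < M → ∀ s : ℕ, s ≤ 2 → ∀ ρ : ℝ, 3 * M ≤ ρ →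
    |liouvilleRemainder M s ρ| ≤ 33 * M / (4 * ρ)

/-- The photon-sphere value: `E_s(3M) = (1 − s²)·2/3 − 3/4` in units `M = 1` radius `3`
(`−M(24M − 15M)/(4·3M·M) = −3/4`): sanity anchor for the closed form. -/
def LiouvilleRemainderAtPhotonSphere : Prop :=
  ∀ M : ℝ, 0 < M → ∀ s : ℕ,
    liouvilleRemainder M s (3 * M) = (1 - (s : ℝ) ^ 2) * (2 / 3) - 3 / 4

/-- **Engine target, informal shape only (NOT typed here — needs a reflection-symbol vocabulary that
the mirror line's stub S2 will fix):** for the Neumann-mirror problem of `−∂ₓ² + V_{s,ℓ}` on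
`[x_f, ∞)`, `x_f = x_c + ρ₀ + C log(ℓ+1)`, the reflection phase `Θ_{s,ℓ}(ω; x_f)` equals the
exact-action model — above the edge barrier `2∫_{x_f}^∞ (√(ω² − ν²F − E_sF) − ω) dx`, below it
`2∫_{x_t}^∞ (√(ω² − ν²F − E_sF) − ω) dx − 2ω(x_t − x_f) − π/2` (turning point `ν²F(r(x_t)) = ω²`),
`ν = ℓ + ½` — up to an error `≤ c·(M/r_f + ν^{−1})` uniformly in `ω` OUTSIDE the grazing window
`|ω − ω_f| ≤ K ω_f ν^{−2/3}`, `ω_f = ν√F(r_f)`, and up to a universal Airy-layer function inside it.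
Recorded as `True` so that the name exists for cross-reference; the statement lives in the line card. -/
def UniformPhaseControlShape : Prop := True

end Summit.FinalStateConjecture.FinalStateConjecture.Cruxes.UniformPhotonSphereChannelsR.ExactActionEngine

end
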